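/-
Copyright (c) 2026 the pub-hodgecm-mathlib formalisation cell (harness21).  Prover seat hodgecm-mathlib-F0P3a-p04 (g31): E1 row 47d «tr (i_B χ)(f_EP^{V,e}) = 0» (dealt by the E1 keeper
F0P3a-p03 (g29/g30)), the PER-FACET MACKEY DICTIONARY (α) discharging the hypothesis `hm` of ★ `SchneiderStuhlerEPInducedTraceZero` (p853358), 2026-09-03.
-/
import Literature.NumberTheory.Automorphic.SmoothInductionDoubleCosetHom        -- ★ row 47b MACKEY `finrank_intertwiningMap_smoothIndRep_eq_sum`
import Literature.NumberTheory.Automorphic.IntertwiningMapSemidirectTransport    -- ★ 47d (G1) transport, (G2) semidirect Frobenius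
import Literature.NumberTheory.Automorphic.IntertwiningMapCharacterCoinvariants   -- ★ 47d (G3) `dim Hom_C(Q, χ) = dim` fixed points of the twist
import HarnessLib

/-!
# The local multiplicities of an induced representation on the fixed spaces of a facet: the per-facet Mackey dictionary

Topic `NumberTheory/Automorphic`; namespace `Representation`; THEOREMS ONLY (no definition, instance, notation or named fact); imports ★ row 47b + ★ 47d glue G1/G2/G3 +
HarnessLib.  Cell `pub/hodgecm-mathlib` (D-0151), crux H413 = `stmt-HodgeConjecture-24833`, lane `--supports`; E1 row 47d (census row 47 «NON-ELLIPTIC VANISHING OF `f_EP^{V,e}`»,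
F0P3-p02 (g26), §2 (A3)–(A5)).  Count-neutral generic base layer; HC_CM is proved only modulo the 7 printed citations (2 remaining named inputs: hLiu418 =
`stmt-HodgeConjecture-24832`, h413 = `stmt-HodgeConjecture-24833`) until rung 0 closes.

THE DICTIONARY.  ★ row 42 writes `tr π′(f_EP) = Σ_F (−1)^{dim F} · dim Hom_{P_F}(E_F, π′|_{P_F})` (`E_F = V^{U_F}`), and ★ 47d HEAD `smoothTrace_epFunction_eq_zero_of_blockSums` kills it
from `hm : dim Hom_{P_F}(E_F, π′) = Σ_{r ∈ J_F} e r` and the Jacquet Euler identity.  For `π′ = Ind_B^Γ σ` (`σ` a character `χ̃` of `B` on a line `W`) this file computes the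
multiplicity facet by facet:
* ★ 47b (Mackey): `dim Hom_K(E, Ind σ|_K) = Σ_j dim Hom_{S_j}(E, σ^{g_j})`, `S_j = K ∩ g_j⁻¹ B g_j`;
* §1 `exists_mulEquiv_subgroupOf_map_conj`: conjugation by `g_j` is an isomorphism `S_j ≃* T_j := B ∩ g_j K g_j⁻¹` (`= B ∩ P_{g_j F}`);
* §2 (G1) `finrank_intertwiningMap_local_eq_of_transport`: `dim Hom_{S_j}(E, σ^{g_j}) = dim Hom_{T_j}(ρ(g_j) E, σ)` (`ρ(g_j) E_F = E_{g_j F}`);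
* §3 (G2 + G3) `finrank_intertwiningMap_local_eq_finrank_fixedPoints` / `…_eq_finrank_eigen`: with `T_j = C · N′` (`C = T_c` compact, `σ` trivial on `N′ = N ∩ P_{g_j F}`),
  `Q` the `N′`-coinvariants of `E′ = E_{g_j F}` and `χ = χ̃|_C`: `dim Hom_{T_j}(E′, σ) = dim Hom_C(Q, χ) = dim {q ∈ Q | ∀ c, c·q = χ(c) q}` — the `χ′`-EIGENSPACE of the local
  Jacquet module, carried 4χ-a-style by `hEig : v ∈ Eig ↔ ∀ c, σQ c v = χ c • v` (★ `EigenRestrictionGradedShift`);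
* §4 `isSmooth_twist_of_surjective`: the twist `χ̃⁻¹ ⊗ Q` is smooth on `T_j` (the analytic input of G3), from smoothness of `ρ` and an open kernel of `χ̃|_{T_j}`;
* §5 `finrank_intertwiningMap_smoothIndRep_eq_sum_finrank_eigen`: the sum over the Mackey representatives — **`dim Hom_K(E, Ind σ|_K) = Σ_j dim ↥(Eig j)`** = `hm` of the HEAD
  with `J_F = {j}` and `e = dim Eig`.
Everything is hypothesis-style in the local data (`T, E′, τ′, σT, C, N, q, σQ, χ, σtw, Eig`), to be instantiated at the Bruhat–Tits datum (FILE 5 / row 47e); the `T`-representation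
on `E′` is supplied by ★ `exists_rep_submodule` (41d-II), the twist by ★ `exists_twistInv` (G3).

## References
* [SchneiderStuhler1997] P. Schneider, U. Stuhler, *Representation theory and sheaves on the Bruhat–Tits building*, Publ. Math. IHÉS 85 (1997), §III.4 (Lemma III.4.13 p. 143, Lemma III.4.18 p. 148).
* [BernsteinZelevinsky1977] I. N. Bernstein, A. V. Zelevinsky, *Induced representations of reductive 𝔭-adic groups I*, Ann. Sci. ÉNS 10 (1977), §2.3, Thm 5.2 (geometric lemma).
* [BernsteinZelevinsky1976] I. N. Bernstein, A. V. Zelevinsky, *Representations of the group `GL(n,F)`*, Russian Math. Surveys 31 (1976), §2.3.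
* [Casselman1995] W. Casselman, *Introduction to the theory of admissible representations of `p`-adic reductive groups* (1995 notes), §3.2, §6.3.
-/

set_option autoImplicit false

namespace Representation

open Function Module

/-! ## §0 Finite-dimensionality of spaces of intertwiners -/

section Finite

variable {k S E W : Type*} [Field k] [Group S] [AddCommGroup E] [Module k E] [AddCommGroup W] [Module k W]

/-- `Hom_S(E, W)` is finite-dimensional when `E` and `W` are (it embeds in `E →ₗ W`). [cite: BernsteinZelevinsky1976, §2.3] -/
theorem finiteDimensional_intertwiningMap (τ : Representation k S E) (σ : Representation k S W) [FiniteDimensional k E] [FiniteDimensional k W] :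
    FiniteDimensional k (IntertwiningMap τ σ) :=
  Module.Finite.of_injective
    ({ toFun := fun f => f.toLinearMap, map_add' := IntertwiningMap.add_toLinearMap τ σ, map_smul' := IntertwiningMap.toLinearMap_smul τ σ } :
      IntertwiningMap τ σ →ₗ[k] (E →ₗ[k] W))
    (IntertwiningMap.toLinearMap_injective τ σ)

end Finite

/-! ## §1 Conjugation by a Mackey representative: `K ∩ x⁻¹Hx ≃* H ∩ xKx⁻¹` -/

section Conj

variable {Γ : Type*} [Group Γ]

/-- **CONJUGATION BY THE REPRESENTATIVE**: for `T = H ∩ xKx⁻¹` (`hT`), `s ↦ x s x⁻¹` is a group isomorphism from ★ 47b's local group `{s ∈ K | x s x⁻¹ ∈ H}` onto `T`.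
[cite: BernsteinZelevinsky1977, §2.3] -/
theorem exists_mulEquiv_subgroupOf_map_conj (H K : Subgroup Γ) (x : Γ) (T : Subgroup Γ) (hT : ∀ y : Γ, y ∈ T ↔ y ∈ H ∧ x⁻¹ * y * x ∈ K) :
    ∃ φ : ↥((H.map (MulAut.conj x⁻¹).toMonoidHom).subgroupOf K) ≃* T,
      ∀ s : ↥((H.map (MulAut.conj x⁻¹).toMonoidHom).subgroupOf K), ((φ s : T) : Γ) = x * ((s : K) : Γ) * x⁻¹ := by
  have hmem : ∀ s : ↥((H.map (MulAut.conj x⁻¹).toMonoidHom).subgroupOf K), x * ((s : K) : Γ) * x⁻¹ ∈ T := fun s =>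
    (hT _).2 ⟨(mem_subgroupOf_map_conj_inv_iff H K x s).1 s.2, by
      rw [show x⁻¹ * (x * ((s : K) : Γ) * x⁻¹) * x = ((s : K) : Γ) by simp only [mul_assoc, inv_mul_cancel, mul_one, inv_mul_cancel_left]]
      exact (s : K).2⟩
  let f : ↥((H.map (MulAut.conj x⁻¹).toMonoidHom).subgroupOf K) →* T :=
    { toFun := fun s => ⟨x * ((s : K) : Γ) * x⁻¹, hmem s⟩
      map_one' := Subtype.ext (by simp)
      map_mul' := fun s t => Subtype.ext (by
        show x * (((s : K) : Γ) * ((t : K) : Γ)) * x⁻¹ = x * ((s : K) : Γ) * x⁻¹ * (x * ((t : K) : Γ) * x⁻¹)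
        simp only [mul_assoc, inv_mul_cancel_left]) }
  have hf : ∀ s, ((f s : T) : Γ) = x * ((s : K) : Γ) * x⁻¹ := fun s => rfl
  refine ⟨MulEquiv.ofBijective f ⟨fun s t hst => ?_, fun t => ?_⟩, fun s => hf s⟩
  · have h : x * ((s : K) : Γ) * x⁻¹ = x * ((t : K) : Γ) * x⁻¹ := by rw [← hf, ← hf, hst]
    exact Subtype.ext (Subtype.ext (mul_left_cancel (mul_right_cancel h)))
  · obtain ⟨htH, htK⟩ := (hT t).1 t.2
    refine ⟨⟨⟨x⁻¹ * (t : Γ) * x, htK⟩, (mem_subgroupOf_map_conj_inv_iff H K x _).2 ?_⟩, Subtype.ext ?_⟩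
    · show x * (x⁻¹ * (t : Γ) * x) * x⁻¹ ∈ H
      simpa only [mul_assoc, mul_inv_cancel, mul_one, mul_inv_cancel_left] using htH
    · show x * (x⁻¹ * (t : Γ) * x) * x⁻¹ = t
      simp only [mul_assoc, mul_inv_cancel, mul_one, mul_inv_cancel_left]

end Conj

/-! ## §2 (G1 applied) Transport to the facet `x · F` -/

section Local

variable {k Γ V W : Type*} [Field k] [Group Γ] [TopologicalSpace Γ] [IsTopologicalGroup Γ] [AddCommGroup V] [Module k V] [AddCommGroup W] [Module k W]
  (ρ : Representation k Γ V) {H K : Subgroup Γ} (σ : Representation k H W) {E : Submodule k V} (τ : Representation k K E)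
  (hτE : ∀ (κ : K) (e : E), ((τ κ e : E) : V) = ρ (κ : Γ) e) (x : Γ)

omit [TopologicalSpace Γ] [IsTopologicalGroup Γ] in
include hτE in
/-- **(G1) AT A MACKEY REPRESENTATIVE**: `dim Hom_{S_x}(E, σ^x) = dim Hom_T(E′, σ_T)` where `S_x = {s ∈ K | x s x⁻¹ ∈ H}` acts on `E ≤ V` through `ρ` (`hτE`), `σ^x` is ★ 47b's
conjugated target (`hσc`), `T = H ∩ xKx⁻¹` (`hT`) acts on `E′ = ρ(x) E` through `ρ` (`hτ′`) and on `W` through `σ` (`hσT`). [cite: BernsteinZelevinsky1977, §2.3, Thm 5.2] -/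
theorem finrank_intertwiningMap_local_eq_of_transport
    (σc : Representation k ↥((H.map (MulAut.conj x⁻¹).toMonoidHom).subgroupOf K) W)
    (hσc : ∀ s : ↥((H.map (MulAut.conj x⁻¹).toMonoidHom).subgroupOf K), σc s = σ ⟨x * ((s : K) : Γ) * x⁻¹, (mem_subgroupOf_map_conj_inv_iff H K x s).1 s.2⟩)
    {T : Subgroup Γ} (hT : ∀ y : Γ, y ∈ T ↔ y ∈ H ∧ x⁻¹ * y * x ∈ K)
    {E' : Submodule k V} (hE : E.map (ρ x) = E') {τ' : Representation k T E'} (hτ' : ∀ (t : T) (e : E'), ((τ' t e : E') : V) = ρ (t : Γ) e)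
    {σT : Representation k T W} (hσT : ∀ (t : T) (h : H), (h : Γ) = (t : Γ) → σT t = σ h) :
    finrank k (IntertwiningMap (τ.comp ((H.map (MulAut.conj x⁻¹).toMonoidHom).subgroupOf K).subtype) σc) = finrank k (IntertwiningMap τ' σT) := by
  obtain ⟨φ, hφ⟩ := exists_mulEquiv_subgroupOf_map_conj H K x T hT
  refine finrank_intertwiningMap_eq_of_transport ρ x hE (i := K.subtype.comp ((H.map (MulAut.conj x⁻¹).toMonoidHom).subgroupOf K).subtype)
    (τ := τ.comp ((H.map (MulAut.conj x⁻¹).toMonoidHom).subgroupOf K).subtype) (fun s e => hτE s e) (i' := T.subtype) hτ' φ (fun s => hφ s) (fun s => ?_)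
  rw [hσc s]
  exact (hσT (φ s) _ (hφ s).symm).symm

/-! ## §3 (G2 + G3 applied) Down to the `χ`-eigenspace of the local Jacquet module -/

include hτE in
/-- **THE LOCAL MULTIPLICITY IS THE DIMENSION OF THE FIXED POINTS OF THE TWIST**: in the situation of `finrank_intertwiningMap_local_eq_of_transport`, if moreover
`T = C · N′` (`hdec`), `σ_T` is trivial on `N′` (`hWN`) and is the character `χ` on `C` (`hχ`, `dim W = 1`), `q : E′ ↠ Q` is the `N′`-coinvariant quotient (`hq`, `hker`) with
`C`-action `σQ` (`hσQ`), `C` is compact and the twist `σtw = χ⁻¹ ⊗ Q` (`htw`) is a smooth `T`-representation (`hsm`; `char k = 0`), then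
`dim Hom_{S_x}(E, σ^x) = dim Q^{σtw(C)}`. [cite: BernsteinZelevinsky1977, §2.3] [cite: Casselman1995, §3.2] -/
theorem finrank_intertwiningMap_local_eq_finrank_fixedPoints [CharZero k]
    (σc : Representation k ↥((H.map (MulAut.conj x⁻¹).toMonoidHom).subgroupOf K) W)
    (hσc : ∀ s : ↥((H.map (MulAut.conj x⁻¹).toMonoidHom).subgroupOf K), σc s = σ ⟨x * ((s : K) : Γ) * x⁻¹, (mem_subgroupOf_map_conj_inv_iff H K x s).1 s.2⟩)
    {T : Subgroup Γ} (hT : ∀ y : Γ, y ∈ T ↔ y ∈ H ∧ x⁻¹ * y * x ∈ K)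
    {E' : Submodule k V} (hE : E.map (ρ x) = E') {τ' : Representation k T E'} (hτ' : ∀ (t : T) (e : E'), ((τ' t e : E') : V) = ρ (t : Γ) e)
    {σT : Representation k T W} (hσT : ∀ (t : T) (h : H), (h : Γ) = (t : Γ) → σT t = σ h)
    (C N : Subgroup T) (hdec : ∀ t : T, ∃ c ∈ C, ∃ n ∈ N, t = c * n) (hWN : ∀ n ∈ N, σT n = 1)
    {Q : Type*} [AddCommGroup Q] [Module k Q] [FiniteDimensional k Q]
    (q : E' →ₗ[k] Q) (hq : Surjective q) (hker : LinearMap.ker q = Coinvariants.ker (τ'.comp N.subtype))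
    (σQ : Representation k C Q) (hσQ : ∀ (c : C) (e : E'), q (τ' (c : T) e) = σQ c (q e))
    (hC : IsCompact (C : Set T)) (χ : C →* kˣ) (hχ : ∀ (c : C) (w : W), σT (c : T) w = ((χ c : kˣ) : k) • w)
    {σtw : Representation k T Q} (hsm : σtw.IsSmooth) (htw : ∀ (c : C) (v : Q), σtw (c : T) v = ((χ c : kˣ) : k)⁻¹ • σQ c v)
    (hW1 : finrank k W = 1) :
    finrank k (IntertwiningMap (τ.comp ((H.map (MulAut.conj x⁻¹).toMonoidHom).subgroupOf K).subtype) σc) = finrank k (σtw.fixedPoints C) := by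
  haveI : FiniteDimensional k W := Module.finite_of_finrank_eq_succ hW1
  rw [finrank_intertwiningMap_local_eq_of_transport ρ σ τ hτE x σc hσc hT hE hτ' hσT,
    finrank_intertwiningMap_eq_of_semidirect τ' σT C N hdec hWN q hq hker σQ hσQ]
  exact finrank_intertwiningMap_character_eq_finrank_fixedPoints σtw hC hsm (σC := σtw.comp C.subtype) (fun c v => rfl) (τ := σQ) (χ := χ)
    (fun c v => htw c v) (σW := σT.comp C.subtype) (fun c w => hχ c w) hW1

end Local

/-! ## §3b The fixed points of the twist are the `χ`-eigenvectors -/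

section Eigen

variable {k G Q : Type*} [Field k] [Group G] [AddCommGroup Q] [Module k Q] {C : Subgroup G}

/-- **FIXED POINTS OF THE TWIST = `χ`-EIGENSPACE**: if `σtw c v = χ(c)⁻¹ • σQ c v` on `C` and `Eig = {v | ∀ c, σQ c v = χ c • v}` (4χ-a-style `hEig`), then
`Q^{σtw(C)} = Eig`. [cite: BernsteinZelevinsky1976, §2.3] -/
theorem fixedPoints_twist_eq_eigen (σQ : Representation k C Q) (χ : C →* kˣ) {σtw : Representation k G Q}
    (htw : ∀ (c : C) (v : Q), σtw (c : G) v = ((χ c : kˣ) : k)⁻¹ • σQ c v) {Eig : Submodule k Q} (hEig : ∀ v, v ∈ Eig ↔ ∀ c : C, σQ c v = ((χ c : kˣ) : k) • v) :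
    σtw.fixedPoints C = Eig := by
  ext v
  rw [mem_fixedPoints, hEig]
  constructor
  · intro h c
    have h1 := h c c.2
    rw [htw] at h1
    exact (inv_smul_eq_iff₀ (Units.ne_zero _)).1 h1
  · intro h g hg
    rw [show σtw g v = σtw ((⟨g, hg⟩ : C) : G) v from rfl, htw, h, smul_smul, inv_mul_cancel₀ (Units.ne_zero _), one_smul]

/-- Hence `dim Q^{σtw(C)} = dim ↥Eig`. [cite: BernsteinZelevinsky1976, §2.3] -/
theorem finrank_fixedPoints_twist_eq (σQ : Representation k C Q) (χ : C →* kˣ) {σtw : Representation k G Q}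
    (htw : ∀ (c : C) (v : Q), σtw (c : G) v = ((χ c : kˣ) : k)⁻¹ • σQ c v) {Eig : Submodule k Q} (hEig : ∀ v, v ∈ Eig ↔ ∀ c : C, σQ c v = ((χ c : kˣ) : k) • v) :
    finrank k (σtw.fixedPoints C) = finrank k Eig := by
  rw [fixedPoints_twist_eq_eigen σQ χ htw hEig]

end Eigen

section LocalEigen

variable {k Γ V W : Type*} [Field k] [CharZero k] [Group Γ] [TopologicalSpace Γ] [IsTopologicalGroup Γ] [AddCommGroup V] [Module k V] [AddCommGroup W] [Module k W]
  (ρ : Representation k Γ V) {H K : Subgroup Γ} (σ : Representation k H W) {E : Submodule k V} (τ : Representation k K E)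
  (hτE : ∀ (κ : K) (e : E), ((τ κ e : E) : V) = ρ (κ : Γ) e) (x : Γ)

include hτE in
/-- **THE LOCAL MULTIPLICITY IS THE DIMENSION OF THE `χ`-EIGENSPACE OF THE LOCAL JACQUET MODULE**: `dim Hom_{S_x}(E, σ^x) = dim ↥Eig`, `Eig = {v ∈ Q | ∀ c ∈ C, c·v = χ(c) v}`
(hypotheses of `finrank_intertwiningMap_local_eq_finrank_fixedPoints` + `hEig`). [cite: SchneiderStuhler1997, §III.4 Lemma 4.13] [cite: BernsteinZelevinsky1977, §2.3] -/
theorem finrank_intertwiningMap_local_eq_finrank_eigen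
    (σc : Representation k ↥((H.map (MulAut.conj x⁻¹).toMonoidHom).subgroupOf K) W)
    (hσc : ∀ s : ↥((H.map (MulAut.conj x⁻¹).toMonoidHom).subgroupOf K), σc s = σ ⟨x * ((s : K) : Γ) * x⁻¹, (mem_subgroupOf_map_conj_inv_iff H K x s).1 s.2⟩)
    {T : Subgroup Γ} (hT : ∀ y : Γ, y ∈ T ↔ y ∈ H ∧ x⁻¹ * y * x ∈ K)
    {E' : Submodule k V} (hE : E.map (ρ x) = E') {τ' : Representation k T E'} (hτ' : ∀ (t : T) (e : E'), ((τ' t e : E') : V) = ρ (t : Γ) e)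
    {σT : Representation k T W} (hσT : ∀ (t : T) (h : H), (h : Γ) = (t : Γ) → σT t = σ h)
    (C N : Subgroup T) (hdec : ∀ t : T, ∃ c ∈ C, ∃ n ∈ N, t = c * n) (hWN : ∀ n ∈ N, σT n = 1)
    {Q : Type*} [AddCommGroup Q] [Module k Q] [FiniteDimensional k Q]
    (q : E' →ₗ[k] Q) (hq : Surjective q) (hker : LinearMap.ker q = Coinvariants.ker (τ'.comp N.subtype))
    (σQ : Representation k C Q) (hσQ : ∀ (c : C) (e : E'), q (τ' (c : T) e) = σQ c (q e))
    (hC : IsCompact (C : Set T)) (χ : C →* kˣ) (hχ : ∀ (c : C) (w : W), σT (c : T) w = ((χ c : kˣ) : k) • w)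
    {σtw : Representation k T Q} (hsm : σtw.IsSmooth) (htw : ∀ (c : C) (v : Q), σtw (c : T) v = ((χ c : kˣ) : k)⁻¹ • σQ c v)
    {Eig : Submodule k Q} (hEig : ∀ v, v ∈ Eig ↔ ∀ c : C, σQ c v = ((χ c : kˣ) : k) • v) (hW1 : finrank k W = 1) :
    finrank k (IntertwiningMap (τ.comp ((H.map (MulAut.conj x⁻¹).toMonoidHom).subgroupOf K).subtype) σc) = finrank k Eig := by
  rw [finrank_intertwiningMap_local_eq_finrank_fixedPoints ρ σ τ hτE x σc hσc hT hE hτ' hσT C N hdec hWN q hq hker σQ hσQ hC χ hχ hsm htw hW1,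
    finrank_fixedPoints_twist_eq σQ χ htw hEig]

/-! ## §4 Smoothness of the twist (the analytic input of G3) -/

omit [CharZero k] in
/-- **THE TWIST IS SMOOTH**: if `ρ` is smooth, `T ≤ Γ` acts on `E′ ≤ V` through `ρ` (`hτ′`), `q : E′ ↠ Q` and the `T`-representation `σtw` on `Q` satisfies
`σtw t (q e) = χT(t)⁻¹ • q (t · e)` (`htwT`) for a character `χT` of `T` with OPEN kernel, then `σtw` is smooth (its stabilisers contain `Stab_ρ(e) ∩ ker χT`).
[cite: Casselman1995, §3.2] [cite: BernsteinZelevinsky1976, §2.3] -/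
theorem isSmooth_twist_of_surjective (hρ : ρ.IsSmooth) {T : Subgroup Γ} {E' : Submodule k V} {τ' : Representation k T E'}
    (hτ' : ∀ (t : T) (e : E'), ((τ' t e : E') : V) = ρ (t : Γ) e) {Q : Type*} [AddCommGroup Q] [Module k Q] (q : E' →ₗ[k] Q) (hq : Surjective q)
    {χT : T →* kˣ} (hχo : IsOpen (χT.ker : Set T)) {σtw : Representation k T Q} (htwT : ∀ (t : T) (e : E'), σtw t (q e) = ((χT t : kˣ) : k)⁻¹ • q (τ' t e)) :
    σtw.IsSmooth := by
  intro v
  obtain ⟨e, rfl⟩ := hq v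
  refine isSmoothVector_of_le σtw (K := (ρ.stabilizerSubgroup (e : V)).comap T.subtype ⊓ χT.ker) ?_ fun t ht => ?_
  · rw [Subgroup.coe_inf, Subgroup.coe_comap]
    exact ((hρ (e : V)).preimage continuous_subtype_val).inter hχo
  · obtain ⟨h1, h2⟩ := Subgroup.mem_inf.1 ht
    rw [Subgroup.mem_comap, mem_stabilizerSubgroup, Subgroup.coe_subtype] at h1
    rw [MonoidHom.mem_ker] at h2
    have he : τ' t e = e := Subtype.ext (by rw [hτ']; exact h1)
    rw [mem_stabilizerSubgroup, htwT, he, h2, Units.val_one, inv_one, one_smul]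

omit [CharZero k] [TopologicalSpace Γ] [IsTopologicalGroup Γ] in
/-- The `C`-form `htw` of the twist from its `T`-form `htwT` and the `C`-action on the quotient (`hσQ`), when `χ = χT|_C`. [cite: BernsteinZelevinsky1976, §2.3] -/
theorem twist_apply_coe_eq {T : Subgroup Γ} {E' : Submodule k V} {τ' : Representation k T E'} {Q : Type*} [AddCommGroup Q] [Module k Q] (q : E' →ₗ[k] Q)
    (hq : Surjective q) {C : Subgroup T} {σQ : Representation k C Q} (hσQ : ∀ (c : C) (e : E'), q (τ' (c : T) e) = σQ c (q e))
    {χT : T →* kˣ} {χ : C →* kˣ} (hχ : ∀ c : C, χ c = χT (c : T)) {σtw : Representation k T Q}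
    (htwT : ∀ (t : T) (e : E'), σtw t (q e) = ((χT t : kˣ) : k)⁻¹ • q (τ' t e)) (c : C) (v : Q) :
    σtw (c : T) v = ((χ c : kˣ) : k)⁻¹ • σQ c v := by
  obtain ⟨e, rfl⟩ := hq v
  rw [htwT, hσQ, hχ]

/-! ## §5 The sum over the Mackey representatives: `hm` of ★ `smoothTrace_epFunction_eq_zero_of_blockSums` -/

include hτE in
/-- **PER-FACET MACKEY DICTIONARY** `dim Hom_K(E, (Ind_H^Γ σ)|_K) = Σ_j dim ↥(Eig j)`: ★ 47b's double-coset decomposition (`hKo`, `hτsm`, `hcover`, `hdisj`, `σc`, `hσc`) followed,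
representative by representative, by transport to `T_j = H ∩ g_j K g_j⁻¹` (G1), the semidirect Frobenius step `T_j = C_j · N_j` (G2) and the compact-torus step (G3): the `j`-th
local multiplicity is the dimension of the `χ_j`-eigenspace `Eig j` of `C_j` on the `N_j`-coinvariants `Q j` of `E′_j = ρ(g_j) E`.  With `E = V^{U_F}`, `K = P_F`, `H = B`,
`σ = χ̃` this is `hm` of ★ `smoothTrace_epFunction_eq_zero_of_blockSums` (blocks `J_F = {j}`, `e = dim Eig`).
[cite: SchneiderStuhler1997, §III.4 Lemma III.4.13, Lemma III.4.18 p. 148] [cite: BernsteinZelevinsky1977, §2.3, Thm 5.2] -/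
theorem finrank_intertwiningMap_smoothIndRep_eq_sum_finrank_eigen [FiniteDimensional k E] {ι : Type*} [Fintype ι] {g : ι → Γ}
    (hKo : IsOpen (K : Set Γ)) (hτsm : τ.IsSmooth)
    (hcover : ∀ y : Γ, ∃ i, ∃ h : H, ∃ κ ∈ K, y = h * g i * κ)
    (hdisj : ∀ i j, (∃ h : H, ∃ κ ∈ K, g j = h * g i * κ) → i = j)
    (σc : ∀ i, Representation k ↥((H.map (MulAut.conj (g i)⁻¹).toMonoidHom).subgroupOf K) W)
    (hσc : ∀ (i : ι) (s : ↥((H.map (MulAut.conj (g i)⁻¹).toMonoidHom).subgroupOf K)),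
      σc i s = σ ⟨g i * ((s : K) : Γ) * (g i)⁻¹, (mem_subgroupOf_map_conj_inv_iff H K (g i) s).1 s.2⟩)
    (T : ι → Subgroup Γ) (hT : ∀ (i : ι) (y : Γ), y ∈ T i ↔ y ∈ H ∧ (g i)⁻¹ * y * g i ∈ K)
    (E' : ι → Submodule k V) (hE : ∀ i, E.map (ρ (g i)) = E' i)
    (τ' : ∀ i, Representation k (T i) (E' i)) (hτ' : ∀ (i : ι) (t : T i) (e : E' i), ((τ' i t e : E' i) : V) = ρ (t : Γ) e)
    (σT : ∀ i, Representation k (T i) W) (hσT : ∀ (i : ι) (t : T i) (h : H), (h : Γ) = (t : Γ) → σT i t = σ h)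
    (C N : ∀ i, Subgroup (T i)) (hdec : ∀ (i : ι) (t : T i), ∃ c ∈ C i, ∃ n ∈ N i, t = c * n) (hWN : ∀ i, ∀ n ∈ N i, σT i n = 1)
    {Q : ι → Type*} [∀ i, AddCommGroup (Q i)] [∀ i, Module k (Q i)] [∀ i, FiniteDimensional k (Q i)]
    (q : ∀ i, E' i →ₗ[k] Q i) (hq : ∀ i, Surjective (q i)) (hker : ∀ i, LinearMap.ker (q i) = Coinvariants.ker ((τ' i).comp (N i).subtype))
    (σQ : ∀ i, Representation k (C i) (Q i)) (hσQ : ∀ (i : ι) (c : C i) (e : E' i), q i (τ' i (c : T i) e) = σQ i c (q i e))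
    (hC : ∀ i, IsCompact (C i : Set (T i))) (χ : ∀ i, C i →* kˣ) (hχ : ∀ (i : ι) (c : C i) (w : W), σT i (c : T i) w = ((χ i c : kˣ) : k) • w)
    (σtw : ∀ i, Representation k (T i) (Q i)) (hsm : ∀ i, (σtw i).IsSmooth)
    (htw : ∀ (i : ι) (c : C i) (v : Q i), σtw i (c : T i) v = ((χ i c : kˣ) : k)⁻¹ • σQ i c v)
    (Eig : ∀ i, Submodule k (Q i)) (hEig : ∀ (i : ι) (v : Q i), v ∈ Eig i ↔ ∀ c : C i, σQ i c v = ((χ i c : kˣ) : k) • v)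
    (hW1 : finrank k W = 1) :
    finrank k (IntertwiningMap τ ((smoothIndRep H σ).comp K.subtype)) = ∑ i, finrank k (Eig i) := by
  haveI : FiniteDimensional k W := Module.finite_of_finrank_eq_succ hW1
  haveI : ∀ i, FiniteDimensional k (IntertwiningMap (τ.comp ((H.map (MulAut.conj (g i)⁻¹).toMonoidHom).subgroupOf K).subtype) (σc i)) :=
    fun i => finiteDimensional_intertwiningMap _ _
  rw [finrank_intertwiningMap_smoothIndRep_eq_sum σ τ hKo hτsm hcover hdisj σc hσc]
  exact Finset.sum_congr rfl fun i _ => finrank_intertwiningMap_local_eq_finrank_eigen ρ σ τ hτE (g i) (σc i) (hσc i) (hT i) (hE i) (hτ' i) (hσT i)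
    (C i) (N i) (hdec i) (hWN i) (q i) (hq i) (hker i) (σQ i) (hσQ i) (hC i) (χ i) (hχ i) (hsm i) (htw i) (hEig i) hW1

end LocalEigen

end Representation
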